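/-
COR-CM (cells pub-hodgecm / pub-hodgecm2, stage 2 of the Hodge ladder) — TRANSPOSITION SURGE, item (vi) sub-binder S2, TEAM hComp row U5
(HCOMP-TABLE v1.1+, PATH A, package P2′): the binder `hUnif` of `Transposition/Item6PinReachAlong.lean` DISCHARGED BY NAME at the team's
honest Prop-C.5 datum `Model.honestP5Of h` (b25, `HComp/HonestP5Of.lean`) and the pin embedding `ῑ₁ := conj ∘ ι₁`, CONDITIONAL on the
ONE named fact `h : UnitaryCanonicalModel.exists_recordSystem` ([Deligne 1979] 2.2.5 + Cor. 2.7.21, as typed by htheta-x1 in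
`Literature/AlgebraicGeometry/ShimuraVarieties/UnitaryShimuraCanonicalModel.lean`).  Seat prover-pub-hodgecm2-pin-1-g2-0 (pin-1 gen 2,
owner of record of binder `hComp`).  THEOREMS ONLY; nothing asserted; nothing in the tree edited.  FRAMING: HC_CM is NOT proved.
-/
import Summits.HodgeConjecture.CorCM.B01.Transposition.HComp.HUnifEngine
import Summits.HodgeConjecture.CorCM.B01.Transposition.HComp.HonestP5Of
import HarnessLib

/-!
# TEAM hComp, U5: `hUnif_holds` — the complex-uniformisation binder at the honest datum, from Deligne's canonical model

`Model.hUnif_holds (h : exists_recordSystem)` is the binder `hUnif` of `Model.hComp_of_unif_of_alb_along` (`Item6PinReachAlong.lean`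
:158–169) VERBATIM at `e := fun F ι₁ => (starRingEnd ℂ).comp ι₁` and `P5 := Model.honestP5Of h`.  Per face (Galois CM `F`, `6 ≤ [F:ℚ]`, so
`4 ≤ [F:ℚ]`), real `τ` below `ῑ₁`, threshold `Ksm := K_f(3𝓞_F)` (hcomp-level `HComp.K3`), and every open compact `K ≤ K_f(3)`:
* the slot `Sh(G(τ), h_{V(τ),ῑ₁})_K ⊗_{ῑ₁(E)} ℂ` of the honest datum IS the complex fibre `M_K ⊗_{F,ι₁} ℂ` of THE chosen canonical-model
  system `Model.recordOf h V h4` (b25 `Model.honestP5Of_slotIsoConj`: `X_K := M_K ⊗_{F,c} F`, `ῑ₁ ∘ c = ι₁`; [Liu2021] Prop. C.5 at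
  `τ' = ῑ₁`, Görtz–Wedhorn 4.16);
* its PIECES are the record's field `pieces` (htheta-x1 v5: [Deligne 1979, 2.1.2] «`M_ℂ` is the disjoint sum, indexed by `G(ℚ)\G(𝔸^f)/K`, of
  the `Γ_g\X⁺`» read on ball quotients of the tree's kind on the TAUTOLOGICAL ball of `V^{ι₁}`, NATURAL levels `Γ_g = U(V)(F⁺) ∩ gKg⁻¹`),
  indexed by the finite `Ξ_K` (hcomp-shimura `Model.finite_shimuraIndex`), the levels named in `Level V` by hcomp-level's `HComp.Λ`
  (group clause by `Λ_Γ_map`, `rfl`);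
* `Model.hUnif_of_slotIso_of_pieces` (pin-1, `HComp/HUnifEngine.lean` §3) moves the cofan across the slot isomorphism.
So the Shimura-side half of `hComp` is a tree theorem modulo the cited existence of the canonical model; with hcomp-abcm-1's
`Model.hAlb_holds (hA : Liu2021.albanese_baseChange_isLimit_fan_jacobian)` the reading binder `hComp` of own-htheta's pinned junction is
DERIVED (`Model.hComp_holds`, below) from two CITED theorems as printed + Liu's posited carriers `C` — `Transposition/Item6PinReachClosed.lean`
(pin-1) then instantiates `hReach`.  HC_CM is NOT proved.
-/

noncomputable section

namespace Summit.HodgeConjecture.CorCM.Model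

open CategoryTheory CategoryTheory.Limits AlgebraicGeometry NumberField
open Literature.AlgebraicGeometry.Motives
open Literature.AlgebraicGeometry.ShimuraVarieties
open Literature.AlgebraicGeometry.ShimuraVarieties.UnitaryCanonicalModel
open Literature.NumberTheory.Automorphic
open Literature.NumberTheory.Automorphic.UnitaryGroup
open Literature.NumberTheory.Automorphic.PicardCM
open Literature.NumberTheory.Automorphic.Liu2021
open Literature.NumberTheory.Automorphic.Liu2021.AppendixC
open Summit.HodgeConjecture.CorCM.HComp

/-- **`hUnif` HOLDS at the honest datum `Model.honestP5Of h`, pin `ῑ₁ := conj ∘ ι₁`** — the binder `hUnif` of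
`Model.hComp_of_unif_of_alb_along` (`Transposition/Item6PinReachAlong.lean` :158–169) token for token at
`e := fun F ι₁ => (starRingEnd ℂ).comp ι₁`, `P5 := Model.honestP5Of h`, CONDITIONAL on the named fact `h : exists_recordSystem`
([Deligne 1979] 2.2.5 + Cor. 2.7.21: existence of the canonical-model system of `Sh(Res_{F⁺/ℚ} U(V), h_{V,ῑ₁})` below a neat level, with
its complex uniformisation 2.1.2).  Per face: `4 ≤ [F:ℚ]` from `6 ≤ [F:ℚ]`; `Ksm := K_f(3)` (`HComp.K3`, open compact); for `K ≤ K_f(3)`: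
`Y := M_K ⊗_{F,ι₁} ℂ`, slot iso `Model.honestP5Of_slotIsoConj` (b25), pieces `(Model.recordOf h V h4).pieces ⟨K, hK⟩` (x1 v5), `Cset := Ξ_K`
finite (`Model.finite_shimuraIndex`, hcomp-shimura), `Γ q := HComp.Λ V K hK (g q)` (hcomp-level; clauses `(hB q).1`, `(hB q).2.1` by
`Λ_Γ_map` = `rfl`), engine `Model.hUnif_of_slotIso_of_pieces`.  Glue, ours.  HC_CM is NOT proved; this discharges the SHIMURA-SIDE
binder of `hComp` only, modulo the cited `h`.
[cite: Deligne1979ShimuraVarieties, §2.1.2, 2.2.5 and Cor. 2.7.21] [cite: Liu2021, Prop. C.5 (FJcycle.tex l. 4627–4633), App. C l. 4583–4599] -/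
theorem hUnif_holds (h : exists_recordSystem) :
    ∀ (F : CMField), IsGalois ℚ F → 6 ≤ Module.finrank ℚ F → ∀ (Φ : CMType F) (ι₁ : F →+* ℂ), ι₁ ∈ Φ.1 →
      ∀ (V : HermSpace3 F ι₁) (τ : maximalRealSubfield F →+* ℝ), C5.IsAbove τ ((starRingEnd ℂ).comp ι₁) →
        ∃ Ksm : Subgroup (honestP5Of h F ι₁ V Φ).G, IsOpenCompact Ksm ∧
          ∀ K : C5.OpenCompactSubgroup (honestP5Of h F ι₁ V Φ).G, K.1 ≤ Ksm →
            ∃ (Cset : Type) (_ : Fintype Cset) (X : Cset → SchemeOver ℂ) (B : ∀ c, UnitaryBallUniformisationDatum 2 (X c))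
              (Γ : Cset → Level V)
              (inj : ∀ c, X c ⟶ (baseChangeHom ((starRingEnd ℂ).comp ι₁).fieldRange.subtype).obj
                (((honestP5Of h F ι₁ V Φ).Sh τ ((starRingEnd ℂ).comp ι₁)).obj (C5.OpenCompactSubgroup.transport ((honestP5Of h F ι₁ V Φ).fix τ) K))),
              (∀ c, (B c).Hℂ = V.Hm.map ι₁) ∧
              (∀ c, (B c).Γ.map (Matrix.GeneralLinearGroup.map (B c).τ₁) =
                (Γ c).Γ.map (Matrix.GeneralLinearGroup.map ι₁)) ∧
              Nonempty (IsColimit (Cofan.mk _ inj)) := by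
  refine hUnif_of_slotIso_of_pieces (fun _ ι₁ => (starRingEnd ℂ).comp ι₁) (honestP5Of h) ?_
  intro F _ h6 Φ ι₁ _ V τ _
  have h4 : 4 ≤ Module.finrank ℚ F := by omega
  refine ⟨(K3 V).1, (K3 V).2, fun K hK => ?_⟩
  obtain ⟨g, -, X, ι, hcol, B, hB⟩ := (recordOf h V h4).pieces ⟨K, hK⟩
  haveI := finite_shimuraIndex V h4 (K.1 : Subgroup V.adelicFin) K.2.1
  exact ⟨_, honestP5Of_slotIsoConj h V Φ h4 τ K hK, _, Fintype.ofFinite _, X, ι, hcol, B,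
    fun q => HComp.Λ V K hK (g q), fun q => ⟨(hB q).1, (hB q).2.1⟩⟩

end Summit.HodgeConjecture.CorCM.Model

end
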